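import Literature.NumberTheory.Sieve.HeathBrownCubicTwistedS4Bound
import Literature.NumberTheory.Sieve.HeathBrownCubicTypeIISsum
import HarnessLib

/-!
# Heath-Brown's Lemma 3.10 for a twisted weight: the bound for `S(w)` (§13 p. 83)

D. R. Heath-Brown, *Primes represented by `x³ + 2y³`*, Acta Math. 186 (2001), §13 p. 83 — the final
assembly `S = S₁ + S₃ + 2S₄⁺ ≪ XV(Y⁻¹ + Y⁶⁰X^{-τ/2} + Y¹⁶Q₁^{-1/4} + Y¹⁶Q₁⁴e^{-c√log L})(log X)^c` — for
the twisted weight `w(β̂)F_β`, `w` `d`-periodic with `|w| ≤ 1`, and hypothesis (3.14) up to `d·Q₁`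
(Heath-Brown–Moroz 2004, Prop. 4.2 (ii)). The tree's `Ssum_le_of_params` (`HeathBrownCubicTypeIISsum`)
re-run: the arithmetic pieces (`piece_small`, `piece_large`, `piece_classII`, `log_bookkeeping`, budgets) are
the tree's, the inputs are the twisted `S₁(w)`, `S₃(w)`, `S₄⁺(w)` bounds; the only change in the constant is
`C₁ ↦ d³C₁`. PROVED: `Twisted.Ssum_le_of_params`.

## References

* D. R. Heath-Brown, Acta Math. 186 (2001), §13 p. 83. [cite: HeathBrownActa2001, §13 p. 83]
* D. R. Heath-Brown, B. Z. Moroz, Proc. London Math. Soc. 88 (2004), Prop. 4.2. [cite: HeathBrownMoroz2004, Proposition 4.2]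

## Mathlib / tree search

Tree: `HeathBrownCubicTypeIISsum` (`Ssum_le_of_params`, `N_param_facts`, `log_bookkeeping`, `piece_*`),
`HeathBrownCubicTypeIIBudget` (`budget_*`).
-/

noncomputable section

open Finset NumberField

namespace Literature.NumberTheory.Sieve.CubicSieve.Twisted

open LFunctions.CubeRootTwoField CubicPrimes CubicSieve


set_option maxHeartbeats 2000000 in
open scoped Classical in
/-- **The bound for `S = S₁ + S₂`** under explicit parameter inequalities (`T³ = V`, `W = X^{τ/2}`,
`N = 1248(⌊Y⌋₊+1)²`, `Δ₀ = V/(XY)`, `d₀ = VY⁷/X`, `Q₀ = ⌊Q₁^{1/3}⌋₊`), with the constants of the auxiliary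
lemmas (`S₁`, the box divisor sum, Lemma 4.5, Lemma 11.1, the tail) supplied as hypotheses.
[cite: HeathBrownActa2001, §13 p. 83] -/
theorem Ssum_le_of_params {X η τ V T Y Q₁ C₁ c₁ c₅ W : ℝ} {nn : ℕ} {m : Fin (nn + 1) → ℕ}
    {d : ℕ} {w : ℤ × ℤ × ℤ → ℝ}
    -- constants
    {CS CB C₂ C₃ C₁₁ CT κ eS : ℝ} {eB e₂ e₃ E eT : ℕ}
    (hCS : 0 < CS) (hCB : 0 < CB) (hC₂ : 0 < C₂) (hC₃ : 0 < C₃) (hC₁₁ : 0 < C₁₁) (hCT : 0 < CT) (heS : 0 ≤ eS)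
    (hS1 : S1sum X η τ m V T w ≤ CS * X ^ 2 * Real.log X ^ eS)
    (hbox : ∑ v ∈ Bbox T, (idealDivisorCount (Ideal.span {coordElt v}) : ℝ) ^ 2 ≤
      CB * (3 * T) ^ 3 * Real.log (2 * (3 * T) + 2) ^ eB)
    (h45₂ : ∀ (a : ℝ × ℝ × ℝ) (S₀ : ℝ), 2 ≤ S₀ → |a.1| ≤ S₀ ^ 3 → |a.2.1| ≤ S₀ ^ 3 → |a.2.2| ≤ S₀ ^ 3 →
      ∑ v ∈ latticeCube a S₀, (idealDivisorCount (Ideal.span {coordElt v}) : ℝ) ^ 2 ≤ C₂ * S₀ ^ 3 * Real.log S₀ ^ e₂)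
    (h45₃ : ∀ (a : ℝ × ℝ × ℝ) (S₀ : ℝ), 2 ≤ S₀ → |a.1| ≤ S₀ ^ 3 → |a.2.1| ≤ S₀ ^ 3 → |a.2.2| ≤ S₀ ^ 3 →
      ∑ v ∈ latticeCube a S₀, (idealDivisorCount (Ideal.span {coordElt v}) : ℝ) ^ 3 ≤ C₃ * S₀ ^ 3 * Real.log S₀ ^ e₃)
    (h11 : ∀ (a₁ a₂ : ℝ × ℝ × ℝ) (S₀ : ℝ), 2 ≤ S₀ →
      |a₁.1| ≤ S₀ ^ 3 → |a₁.2.1| ≤ S₀ ^ 3 → |a₁.2.2| ≤ S₀ ^ 3 →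
        ∀ D : ℕ, 1 ≤ D → (D : ℝ) ≤ κ * S₀ →
          ∑ b ∈ (latticeCube a₁ S₀).filter IsPrimitiveVec,
              ∑ _x ∈ (latticeCube a₂ S₀).filter (fun x => DvdVec (D : ℤ) (cross3 b x)),
                (idealDivisorCount (Ideal.span {coordElt b}) : ℝ) ^ 2 ≤
            C₁₁ * S₀ ^ 6 / (D : ℝ) ^ 2 * Real.log S₀ ^ E)
    (hTL : TL T (T ^ 3 * Y ^ 7 / X) ≤ CT * (T ^ 6 / (T ^ 3 * Y ^ 7 / X) + T ^ 5) * Real.log T ^ eT)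
    -- structure
    (hη0 : 0 ≤ η) (hη1 : η ≤ 1) (hτ : 0 < τ) (hτ1 : τ ≤ 1) (hm : CoreAdmissible τ m)
    (hd : 0 < d) (hHyp : Hyp314 X τ m ((d : ℝ) * Q₁) C₁ c₁ 3 1)
    (hw1 : ∀ b, |w b| ≤ 1) (hwper : ∀ b u, DvdVec (d : ℤ) u → w (b + u) = w b) (hc₅ : 0 < c₅)
    -- parameters
    (hX : 2 ≤ X) (hlogX : 1 ≤ Real.log X) (hY : 1 ≤ Y) (hQ₁ : 1 ≤ Q₁) (hQ₁X : Q₁ ≤ X)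
    (hT1 : 1 ≤ T) (hTV : T ^ 3 = V) (hTX : T ≤ X) (hT56 : T ^ 2 ≤ 56 * X)
    (hW : W = X ^ (τ / 2)) (hXW : X * W ≤ T ^ 3) (hTW : T ^ 2 * W ≤ X)
    (hYQ : Y ^ 10 * Q₁ ≤ T ^ 2) (hc₅V : c₅ * X * Y ^ 3 ≤ T ^ 3) (hYX : Y ≤ X)
    (hQe : Q₁ ^ (1 / 3 : ℝ) * Real.exp (-(c₁ * Real.sqrt (Real.log (hbL X τ)))) ≤ 1)
    (hs2 : 2 ≤ T / ((1248 * (⌊Y⌋₊ + 1) ^ 2 : ℕ) : ℝ))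
    (hsN : 3 * (((1248 * (⌊Y⌋₊ + 1) ^ 2 : ℕ)) : ℝ) + 2 ≤ (T / ((1248 * (⌊Y⌋₊ + 1) ^ 2 : ℕ) : ℝ)) ^ 2)
    (hsL : hbL X τ ^ 2 ≤ T / ((1248 * (⌊Y⌋₊ + 1) ^ 2 : ℕ) : ℝ)) (hVX : X ≤ 270 * V)
    (hκs : 270 * V / X ≤ κ * (T / ((1248 * (⌊Y⌋₊ + 1) ^ 2 : ℕ) : ℝ)))
    (hΔ1 : 1 ≤ V / (X * Y)) (hΔT : V / (X * Y) ≤ T) (hd₀ : 1 ≤ T ^ 3 * Y ^ 7 / X) :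
    Ssum X η τ m V T w ≤
      (CS + 2 * 81 * 27 * 87808 * 4 ^ eB * CB + 162 * CT + 2 * 81 * 34000000000 * 12 * 9 ^ 5 * (2 + 3 / c₅) * C₁₁ +
          2 * 9 ^ 6 * 414720 * 11 * 81 * (16 + (19968 + 4992 ^ 3)) * C₂ +
          48 * 9 ^ 6 * (4992 ^ 6 * ((d : ℝ) ^ 3 * C₁) ^ 2 + 162 * 3 * (12 + (100 * 4992 ^ 2 + 16 * 4992 ^ 4)) * C₃ ^ (2 / 3 : ℝ))) *
        (X * V) * (Y⁻¹ + Y ^ 60 * X ^ (-(τ / 2)) + Y ^ 16 * Q₁ ^ (-(1 / 4 : ℝ)) +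
          Y ^ 16 * Q₁ ^ 4 * Real.exp (-(c₁ * Real.sqrt (Real.log (hbL X τ))))) *
        Real.log X ^ (eS + (eB : ℝ) + eT + (E + 1 : ℕ) + (e₂ + 1 : ℕ) + (e₃ + 3 : ℕ)) := by
  classical
  -- V := T³
  subst hTV
  set C₁d : ℝ := (d : ℝ) ^ 3 * C₁ with hC₁d
  have hX0 : 0 < X := by linarith
  have hX1 : 1 < X := by linarith
  have hY0 : 0 < Y := by linarith
  have hT : 0 < T := by linarith
  have hQ₁0 : 0 < Q₁ := by linarith
  set LX := Real.log X with hLX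
  -- the hypercube parameter
  set Nn : ℕ := 1248 * (⌊Y⌋₊ + 1) ^ 2 with hNn
  obtain ⟨hN1248, hNY2, hN4992⟩ := N_param_facts hY
  rw [← hNn] at hN1248 hNY2 hN4992
  set N : ℝ := (Nn : ℝ) with hN
  have hN1 : (1 : ℝ) ≤ N := by rw [hN]; exact_mod_cast le_trans (by norm_num) hN1248
  have hN0 : 0 < N := by linarith
  have hNpos : 0 < Nn := by omega
  have hs1 : 1 ≤ T / N := by linarith
  have hsT : T / N ≤ T := div_le_self hT.le hN1
  have hls0 : 0 ≤ Real.log (T / N) := Real.log_nonneg hs1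
  have hls : Real.log (T / N) ≤ LX := (Real.log_le_log (by linarith) hsT).trans (Real.log_le_log hT hTX)
  have hlogT : Real.log T ≤ LX := Real.log_le_log hT hTX
  have hlogT0 : 0 ≤ Real.log T := Real.log_nonneg hT1
  -- `Q₀`
  set Q₀ : ℕ := ⌊Q₁ ^ (1 / 3 : ℝ)⌋₊ with hQ₀
  have hQ13 : 1 ≤ Q₁ ^ (1 / 3 : ℝ) := Real.one_le_rpow hQ₁ (by norm_num)
  have hQ₀1 : 1 ≤ Q₀ := Nat.le_floor (by simpa using hQ13)
  have hQ₀1R : (1 : ℝ) ≤ Q₀ := by exact_mod_cast hQ₀1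
  have hQ₀le : (Q₀ : ℝ) ≤ Q₁ ^ (1 / 3 : ℝ) := Nat.floor_le (by linarith)
  have hQ₀ge : Q₁ ^ (1 / 3 : ℝ) / 2 ≤ (Q₀ : ℝ) := half_le_floor hQ13
  have hQ₀Q₁ : (Q₀ : ℝ) ≤ Q₁ := hQ₀le.trans (by
    calc Q₁ ^ (1 / 3 : ℝ) ≤ Q₁ ^ (1 : ℝ) := Real.rpow_le_rpow_of_exponent_le hQ₁ (by norm_num)
      _ = Q₁ := Real.rpow_one Q₁)
  have hQ₀X : (Q₀ : ℝ) ≤ X := hQ₀Q₁.trans hQ₁X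
  -- `Δ₀`, `d₀`, `W`
  set Δ₀ : ℝ := T ^ 3 / (X * Y) with hΔ₀
  set d₀ : ℝ := T ^ 3 * Y ^ 7 / X with hd₀def
  have hW1 : 1 ≤ W := by rw [hW]; exact Real.one_le_rpow (by linarith) (by linarith)
  have hW0 : 0 < W := by linarith
  have hWinv : X ^ (-(τ / 2)) = W⁻¹ := by rw [hW, Real.rpow_neg hX0.le]
  have hΔD : Δ₀ ≤ 270 * T ^ 3 / X := by
    calc Δ₀ = T ^ 3 / (X * Y) := hΔ₀
      _ ≤ T ^ 3 / X := div_le_div_of_nonneg_left (by positivity) hX0 (le_mul_of_one_le_right hX0.le hY)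
      _ ≤ 270 * T ^ 3 / X := div_le_div_of_nonneg_right (by linarith [pow_pos hT 3]) hX0.le
  have hdX : d₀ ≤ X ^ 9 := by
    rw [hd₀def, div_le_iff₀ hX0]
    have h1 : T ^ 3 ≤ X ^ 3 := pow_le_pow_left₀ hT.le hTX 3
    have h2 : Y ^ 7 ≤ X ^ 7 := pow_le_pow_left₀ hY0.le hYX 7
    calc T ^ 3 * Y ^ 7 ≤ X ^ 3 * X ^ 7 := mul_le_mul h1 h2 (by positivity) (by positivity)
      _ = X ^ 9 * X := by ring
  obtain ⟨-, hlogd, hlogQ₀, hlog3T, hlog6T⟩ :=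
    log_bookkeeping (Q₀ := (Q₀ : ℝ)) hX hlogX hY hYX hT1 hTX hQ₀1R hQ₀X hd₀ hdX
  -- Step 1: `S = S₁ + S₃ + 2 S₄⁺`
  have hdecomp : Ssum X η τ m (T ^ 3) T w =
      S1sum X η τ m (T ^ 3) T w + S3sum X η τ m (T ^ 3) T w Δ₀ + 2 * S4plus X η τ m (T ^ 3) T w Δ₀ := by
    rw [Ssum_eq_S1_add_S2, S2sum_eq_S3_add_S4 Δ₀, S4sum_eq_two_mul_S4plus hX0 hη1 hT rfl Δ₀]; ring
  -- Step 2: `S₁`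
  have hB0 : 0 ≤ X * T ^ 3 := by positivity
  have hS1' : S1sum X η τ m (T ^ 3) T w ≤ CS * (X * T ^ 3) * (Y ^ 60 * W⁻¹) * LX ^ eS := by
    have h1 := budget_S1 hX0.le hY hW0 hXW
    have hL : 0 ≤ LX ^ eS := Real.rpow_nonneg (by linarith) _
    calc S1sum X η τ m (T ^ 3) T w ≤ CS * X ^ 2 * LX ^ eS := hS1
      _ ≤ CS * (X * T ^ 3 / W * Y ^ 60) * LX ^ eS := by gcongr
      _ = CS * (X * T ^ 3) * (Y ^ 60 * W⁻¹) * LX ^ eS := by field_simp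
  -- Step 3: `S₃`
  have hS3' : |S3sum X η τ m (T ^ 3) T w Δ₀| ≤ 2 * 81 * 27 * 87808 * 4 ^ eB * CB * (X * T ^ 3) * Y⁻¹ * LX ^ eB := by
    have h := abs_S3sum_le (τ := τ) (m := m) (V := T ^ 3) (w := w) hw1 hX0.le hη1 hT (Δ₀ := Δ₀) (by positivity)
    have hFb : ∑ b ∈ Bbox T, CubicSieve.Fb X τ m (T ^ 3) T b ^ 2 ≤ 81 * (CB * (3 * T) ^ 3 * (4 * LX) ^ eB) := by
      calc ∑ b ∈ Bbox T, CubicSieve.Fb X τ m (T ^ 3) T b ^ 2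
          ≤ ∑ b ∈ Bbox T, 81 * (idealDivisorCount (Ideal.span {coordElt b}) : ℝ) ^ 2 :=
            sum_le_sum fun b _ => CubicSieve.Fb_sq_le hX1 hτ hτ1 hm b
        _ = 81 * ∑ b ∈ Bbox T, (idealDivisorCount (Ideal.span {coordElt b}) : ℝ) ^ 2 := by rw [mul_sum]
        _ ≤ 81 * (CB * (3 * T) ^ 3 * Real.log (2 * (3 * T) + 2) ^ eB) := by gcongr
        _ ≤ 81 * (CB * (3 * T) ^ 3 * (4 * LX) ^ eB) := by
            gcongr
            exact Real.log_nonneg (by linarith)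
    have hbud := budget_S3 hX0 hY hT rfl hΔT hT56
    have hF0 : 0 ≤ ∑ b ∈ Bbox T, CubicSieve.Fb X τ m (T ^ 3) T b ^ 2 := sum_nonneg fun b _ => sq_nonneg _
    have hΔ00 : 0 ≤ Δ₀ * (6 * T + Δ₀) * (56 * X / T ^ 2 + 1) ^ 2 := by positivity
    calc |S3sum X η τ m (T ^ 3) T w Δ₀| ≤ 2 * (∑ b ∈ Bbox T, CubicSieve.Fb X τ m (T ^ 3) T b ^ 2) * (Δ₀ * (6 * T + Δ₀) * (56 * X / T ^ 2 + 1) ^ 2) := h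
      _ ≤ 2 * (81 * (CB * (3 * T) ^ 3 * (4 * LX) ^ eB)) * (87808 * X / Y) := by gcongr
      _ = 2 * 81 * 27 * 87808 * 4 ^ eB * CB * (X * T ^ 3) * Y⁻¹ * LX ^ eB := by
          rw [mul_pow, mul_pow]; field_simp; norm_num
  -- Step 4: `S₄⁺`
  have hS4 := abs_S4plus_le (X := X) (η := η) (τ := τ) (V := T ^ 3) (T := T) (w := w) (N := Nn) hX1 hη0 hη1 hτ hτ1 hm
    hd hHyp hw1 hwper hT rfl hN1248 hs2 hsN hsL hVX hC₂ hC₃ hC₁₁ h45₂ h45₃ h11 hκs hQ₀1 hQ₀Q₁ hΔ1 hΔD hd₀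
  have eC : ((d : ℝ) ^ 3 * (C₁ * T ^ 3 * Real.exp (-(c₁ * Real.sqrt (Real.log (hbL X τ)))))) =
      C₁d * T ^ 3 * Real.exp (-(c₁ * Real.sqrt (Real.log (hbL X τ)))) := by rw [hC₁d]; ring
  rw [eC] at hS4
  -- the pieces
  have hp_II := piece_classII (E := E) hX hlogX hY hYX hT hN1 hNY2 hΔ₀ hc₅ hc₅V hC₁₁.le hls0 hls
  have hp_L := piece_large (e₂ := e₂) (Q₀ := Q₀) hX hlogX hY hT hN1 hN4992 hs1 hΔ₀ hd₀def hd₀ hlogd hQ₁ hQ₀ge hW1 hTW hC₂.le hls0 hls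
  have hp_S := piece_small (C₁ := C₁d) (e₃ := e₃) (u := c₁ * Real.sqrt (Real.log (hbL X τ))) hX hlogX hY hT1 hN1 hN4992 hs1 hΔ₀ hQ₁
    hQ₀1R hQ₀le hlogQ₀ hlog3T hYQ hQe hC₃.le hls0 hls
  have hp_T : 162 * TL T d₀ ≤ 162 * CT * (X * T ^ 3) * (Y⁻¹ + Y ^ 60 * W⁻¹) * LX ^ eT := by
    have hbud := budget_TL hX0 hY hT hW0 hTW
    have h1 : TL T d₀ ≤ CT * (X * T ^ 3 / Y + X * T ^ 3 / W * Y ^ 60) * LX ^ eT := by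
      calc TL T d₀ ≤ CT * (T ^ 6 / (T ^ 3 * Y ^ 7 / X) + T ^ 5) * Real.log T ^ eT := hTL
        _ ≤ CT * (X * T ^ 3 / Y + X * T ^ 3 / W * Y ^ 60) * LX ^ eT := by
            gcongr
    calc 162 * TL T d₀ ≤ 162 * (CT * (X * T ^ 3 / Y + X * T ^ 3 / W * Y ^ 60) * LX ^ eT) := by linarith
      _ = 162 * CT * (X * T ^ 3) * (Y⁻¹ + Y ^ 60 * W⁻¹) * LX ^ eT := by field_simp
  -- `2|S₄⁺| ≤ small + large + tail + classII`
  have h2S4 : 2 * |S4plus X η τ m (T ^ 3) T w Δ₀| ≤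
      48 * 9 ^ 6 * (X * T ^ 3) *
        (4992 ^ 6 * C₁d ^ 2 * (Y ^ 16 * Q₁ ^ 4 * Real.exp (-(c₁ * Real.sqrt (Real.log (hbL X τ))))) * LX +
          486 * C₃ ^ (2 / 3 : ℝ) * (12 * (Y ^ 16 * Q₁ ^ (-(1 / 4 : ℝ))) + (100 * 4992 ^ 2 + 16 * 4992 ^ 4) * Y⁻¹) * LX ^ (e₃ + 3)) +
      2 * 9 ^ 6 * 414720 * 11 * 81 * C₂ * (X * T ^ 3) *
        (16 * (Y ^ 16 * Q₁ ^ (-(1 / 4 : ℝ))) + (19968 + 4992 ^ 3) * (Y ^ 60 / W)) * LX ^ (e₂ + 1) +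
      162 * CT * (X * T ^ 3) * (Y⁻¹ + Y ^ 60 * W⁻¹) * LX ^ eT +
      2 * 81 * 34000000000 * 12 * 9 ^ 5 * (2 + 3 / c₅) * C₁₁ * (X * T ^ 3 * Y⁻¹) * LX ^ (E + 1) := by
    have h2 := mul_le_mul_of_nonneg_left hS4 (by norm_num : (0:ℝ) ≤ 2)
    rw [← hN] at h2
    linarith [h2, hp_S, hp_L, hp_T, hp_II]
  -- Step 5: domination by the four target terms (big numerals abstracted first)
  set u1 : ℝ := Y⁻¹ with hu1
  set u2 : ℝ := Y ^ 60 * W⁻¹ with hu2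
  set u3 : ℝ := Y ^ 16 * Q₁ ^ (-(1 / 4 : ℝ)) with hu3
  set u4 : ℝ := Y ^ 16 * Q₁ ^ 4 * Real.exp (-(c₁ * Real.sqrt (Real.log (hbL X τ)))) with hu4
  rw [hWinv]
  have hYW : Y ^ 60 / W = u2 := by rw [hu2, div_eq_mul_inv]
  rw [hYW] at h2S4
  have hK₁0 : (0 : ℝ) ≤ 100 * 4992 ^ 2 + 16 * 4992 ^ 4 := by norm_num
  have hK₂0 : (0 : ℝ) ≤ 19968 + 4992 ^ 3 := by norm_num
  have hK₃0 : (0 : ℝ) ≤ 2 * 81 * 27 * 87808 := by norm_num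
  have hK₄0 : (0 : ℝ) ≤ 2 * 81 * 34000000000 * 12 * 9 ^ 5 := by norm_num
  have hK₅0 : (0 : ℝ) ≤ 2 * 9 ^ 6 * 414720 * 11 * 81 := by norm_num
  have hK₆0 : (0 : ℝ) ≤ 48 * 9 ^ 6 := by norm_num
  have hK₇0 : (0 : ℝ) ≤ 4992 ^ 6 := by norm_num
  generalize (100 * 4992 ^ 2 + 16 * 4992 ^ 4 : ℝ) = K₁ at h2S4 hK₁0 ⊢
  generalize (19968 + 4992 ^ 3 : ℝ) = K₂ at h2S4 hK₂0 ⊢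
  generalize (2 * 81 * 27 * 87808 : ℝ) = K₃ at hS3' hK₃0 ⊢
  generalize (2 * 81 * 34000000000 * 12 * 9 ^ 5 : ℝ) = K₄ at h2S4 hK₄0 ⊢
  generalize (2 * 9 ^ 6 * 414720 * 11 * 81 : ℝ) = K₅ at h2S4 hK₅0 ⊢
  generalize (48 * 9 ^ 6 : ℝ) = K₆ at h2S4 hK₆0 ⊢
  generalize (4992 ^ 6 : ℝ) = K₇ at h2S4 hK₇0 ⊢
  set U : ℝ := u1 + u2 + u3 + u4 with hU
  have hu10 : 0 ≤ u1 := by positivity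
  have hu20 : 0 ≤ u2 := by positivity
  have hu30 : 0 ≤ u3 := by have : 0 ≤ Q₁ ^ (-(1 / 4 : ℝ)) := Real.rpow_nonneg hQ₁0.le _; positivity
  have hu40 : 0 ≤ u4 := by positivity
  have hU0 : 0 ≤ U := by linarith
  have hU1 : u1 ≤ U := by linarith
  have hU2 : u2 ≤ U := by linarith
  have hU3 : u3 ≤ U := by linarith
  have hU4 : u4 ≤ U := by linarith
  set etot : ℝ := eS + (eB : ℝ) + eT + (E + 1 : ℕ) + (e₂ + 1 : ℕ) + (e₃ + 3 : ℕ) with hetot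
  set Lmax : ℝ := LX ^ etot with hLmax
  have hLX0 : 0 ≤ LX := by linarith
  have heB0 : (0 : ℝ) ≤ eB := Nat.cast_nonneg _
  have heT0 : (0 : ℝ) ≤ eT := Nat.cast_nonneg _
  have hE0 : (0 : ℝ) ≤ ((E + 1 : ℕ) : ℝ) := Nat.cast_nonneg _
  have he20 : (0 : ℝ) ≤ ((e₂ + 1 : ℕ) : ℝ) := Nat.cast_nonneg _
  have he33 : (3 : ℝ) ≤ ((e₃ + 3 : ℕ) : ℝ) := by push_cast; linarith [(Nat.cast_nonneg e₃ : (0:ℝ) ≤ e₃)]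
  have hLnat : ∀ n : ℕ, (n : ℝ) ≤ etot → LX ^ n ≤ Lmax := fun n hn => by
    rw [← Real.rpow_natCast]; exact Real.rpow_le_rpow_of_exponent_le hlogX hn
  have hLS : LX ^ eS ≤ Lmax := Real.rpow_le_rpow_of_exponent_le hlogX (by linarith)
  have hLB : LX ^ eB ≤ Lmax := hLnat eB (by linarith)
  have hLT : LX ^ eT ≤ Lmax := hLnat eT (by linarith)
  have hLE : LX ^ (E + 1) ≤ Lmax := hLnat (E + 1) (by linarith)
  have hL2 : LX ^ (e₂ + 1) ≤ Lmax := hLnat (e₂ + 1) (by linarith)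
  have hL3 : LX ^ (e₃ + 3) ≤ Lmax := hLnat (e₃ + 3) (by linarith)
  have hL1 : LX ≤ Lmax := by
    have := hLnat 1 (by push_cast; linarith)
    simpa using this
  have hLmax0 : 0 ≤ Lmax := Real.rpow_nonneg hLX0 _
  set M : ℝ := X * T ^ 3 * U * Lmax with hM
  set B : ℝ := X * T ^ 3 with hB
  -- (a) `S₁`
  have qa : CS * B * u2 * LX ^ eS ≤ CS * M := by
    rw [hM]; exact piece_le hCS.le hB0 hu20 hU2 (Real.rpow_nonneg hLX0 eS) hLS
  -- (b) `S₃`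
  have qb : K₃ * 4 ^ eB * CB * B * u1 * LX ^ eB ≤ K₃ * 4 ^ eB * CB * M := by
    rw [hM]; exact piece_le (by positivity) hB0 hu10 hU1 (pow_nonneg hLX0 eB) hLB
  -- (c) small moduli
  have qc : K₆ * B * (K₇ * C₁d ^ 2 * u4 * LX + 486 * C₃ ^ (2 / 3 : ℝ) * (12 * u3 + K₁ * u1) * LX ^ (e₃ + 3)) ≤
      K₆ * (K₇ * C₁d ^ 2 + 162 * 3 * (12 + K₁) * C₃ ^ (2 / 3 : ℝ)) * M := by
    have hC₃r : 0 ≤ C₃ ^ (2 / 3 : ℝ) := Real.rpow_nonneg hC₃.le _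
    have c1 : K₇ * C₁d ^ 2 * u4 * LX ≤ K₇ * C₁d ^ 2 * (U * Lmax) := by
      have h1 : u4 * LX ≤ U * Lmax := mul_le_mul hU4 hL1 hLX0 hU0
      have h0 : 0 ≤ K₇ * C₁d ^ 2 := by positivity
      calc K₇ * C₁d ^ 2 * u4 * LX = K₇ * C₁d ^ 2 * (u4 * LX) := by ring
        _ ≤ K₇ * C₁d ^ 2 * (U * Lmax) := mul_le_mul_of_nonneg_left h1 h0
    have c2 : 486 * C₃ ^ (2 / 3 : ℝ) * (12 * u3 + K₁ * u1) * LX ^ (e₃ + 3) ≤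
        486 * C₃ ^ (2 / 3 : ℝ) * ((12 + K₁) * U) * Lmax := by
      have hK : K₁ * u1 ≤ K₁ * U := mul_le_mul_of_nonneg_left hU1 hK₁0
      have hcomb : 12 * u3 + K₁ * u1 ≤ (12 + K₁) * U := by linarith
      have hcomb0 : 0 ≤ 12 * u3 + K₁ * u1 := by positivity
      exact mul_le_mul (mul_le_mul_of_nonneg_left hcomb (by positivity)) hL3 (pow_nonneg hLX0 _) (by positivity)
    have hsum := add_le_add c1 c2
    calc K₆ * B * (K₇ * C₁d ^ 2 * u4 * LX + 486 * C₃ ^ (2 / 3 : ℝ) * (12 * u3 + K₁ * u1) * LX ^ (e₃ + 3))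
        ≤ K₆ * B * (K₇ * C₁d ^ 2 * (U * Lmax) + 486 * C₃ ^ (2 / 3 : ℝ) * ((12 + K₁) * U) * Lmax) :=
          mul_le_mul_of_nonneg_left hsum (by positivity)
      _ = _ := by rw [hM]; ring
  -- (d) large sieve
  have qd : K₅ * C₂ * B * (16 * u3 + K₂ * u2) * LX ^ (e₂ + 1) ≤ K₅ * (16 + K₂) * C₂ * M := by
    have hK : K₂ * u2 ≤ K₂ * U := mul_le_mul_of_nonneg_left hU2 hK₂0
    have hcomb : 16 * u3 + K₂ * u2 ≤ (16 + K₂) * U := by linarith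
    have hcomb0 : 0 ≤ 16 * u3 + K₂ * u2 := by positivity
    have h1 : (16 * u3 + K₂ * u2) * LX ^ (e₂ + 1) ≤ ((16 + K₂) * U) * Lmax :=
      mul_le_mul hcomb hL2 (pow_nonneg hLX0 _) (by positivity)
    calc K₅ * C₂ * B * (16 * u3 + K₂ * u2) * LX ^ (e₂ + 1)
        = K₅ * C₂ * B * ((16 * u3 + K₂ * u2) * LX ^ (e₂ + 1)) := by ring
      _ ≤ K₅ * C₂ * B * (((16 + K₂) * U) * Lmax) := mul_le_mul_of_nonneg_left h1 (by positivity)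
      _ = _ := by rw [hM]; ring
  -- (e) tail
  have qe : 162 * CT * B * (u1 + u2) * LX ^ eT ≤ 162 * CT * M := by
    rw [hM]
    exact piece_le (by positivity) hB0 (by positivity : 0 ≤ u1 + u2) (by linarith : u1 + u2 ≤ U) (pow_nonneg hLX0 eT) hLT
  -- (f) Class II
  have qf : K₄ * (2 + 3 / c₅) * C₁₁ * (B * u1) * LX ^ (E + 1) ≤ K₄ * (2 + 3 / c₅) * C₁₁ * M := by
    rw [hM]
    have := piece_le (c := K₄ * (2 + 3 / c₅) * C₁₁) (by positivity) hB0 hu10 hU1 (pow_nonneg hLX0 (E + 1)) hLE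
    calc K₄ * (2 + 3 / c₅) * C₁₁ * (B * u1) * LX ^ (E + 1) = K₄ * (2 + 3 / c₅) * C₁₁ * B * u1 * LX ^ (E + 1) := by ring
      _ ≤ _ := this
  -- conclusion
  have hS3le : S3sum X η τ m (T ^ 3) T w Δ₀ ≤ |S3sum X η τ m (T ^ 3) T w Δ₀| := le_abs_self _
  have hS4le : S4plus X η τ m (T ^ 3) T w Δ₀ ≤ |S4plus X η τ m (T ^ 3) T w Δ₀| := le_abs_self _
  have hfinal : Ssum X η τ m (T ^ 3) T w ≤
      (CS + K₃ * 4 ^ eB * CB + 162 * CT + K₄ * (2 + 3 / c₅) * C₁₁ + K₅ * (16 + K₂) * C₂ +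
          K₆ * (K₇ * C₁d ^ 2 + 162 * 3 * (12 + K₁) * C₃ ^ (2 / 3 : ℝ))) * M := by
    rw [hdecomp]
    linarith [hS1', hS3', h2S4, qa, qb, qc, qd, qe, qf, hS3le, hS4le]
  calc Ssum X η τ m (T ^ 3) T w ≤ _ := hfinal
    _ = _ := by rw [hM]; ring

end Literature.NumberTheory.Sieve.CubicSieve.Twisted

end
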